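import Summits.QuantumFields.YangMills.Theorems.BalabanUVNodesN27AtAllPinsOfRecord13CoPHVCutFSCFiniteVolume
import Summits.QuantumFields.YangMills.Theorems.BalabanUVNodesN18KernelStepRateKingMechanismWindowed

/-!
# BalabanUVNodes ∕ N27 = binder B5 AT THE RECORD — storey APK: THE K3⁷ v5 ALL-PINS BILL (four reading pins + the spine pin, FSC key, finite-volume u3 door) WITH THE N18 ROW
# `hS` AND THE (D4) ROW `hW` PRODUCED BY KING's THREE-FACTOR MECHANISM on the record's WINDOWED (1.20) kernels — dag-n18-w4's FILE 3 §6
# (`…N18KernelStepRateKingMechanismWindowed` p608767: `windowedStepRateOfRecord₁₃_of_threeFactorRates` ∕ `…_mono` ⟹ `hS`, `windowedDecayOfRecord₁₃_of_threeFactorSizes … 0 1` ∕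
# `…_anti` ⟹ `hW`), its OFFER (A) «the v5-BILL KNIT in n27's currency — N27 lane's call» (bus I.29898 ∕ I.30153 ∕ ■ l.30875)
# (cell `pub-ymgap`, HUMAN RULING D-0062 Track A, R134 seat `pub-ymgap-dag-n27-c` (N27 B5 composite, s2) gen 14, HOME trigger (t2⁗) «new producer currency at the pinned reading»; K3⁷
# `SpineGivenEndpointR13SepCoPH` = stmt-QuantumFields-20544, `--kind proof --supports 20544 --as helper`; COUNT-NEUTRAL; THEOREMS ONLY, 0 `def`, 0 `sorry`; `N`-generic, `K₀`-generic,
# regime-generic, NO Theses import, does NOT import the skeleton — item faces in leaf `…N27SpineGivenEndpointR13SepCoPHAllPinsOfRecordVKingMechanism`; APF p609292 is the parent storey,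
# kept byte-identical and applied BY NAME)

WHAT IS KERNEL-CHECKED ([bookkeeping]; per guarded tuple ONE application of dag-n18-w4's two §6 producers and their monotonicity faces; then APF §1 ∕ §2 verbatim).
* §0 ★★ `windowedRowsOfRecord₁₃_guarded_of_kingMechanism` — per regime `Rg`, from KING's MECHANISM ROWS keyed `∀ F θ, Provisos₁₃CoPH → Rg → Admissible → …` on `(F, θ)`-DEPENDENT data:
  a `(F, θ, K, k)`-indexed summation lattice `βK F θ K k` with positions `q` in a carrier `PK F θ K k`, a pseudo-distance `ρd` (`hρ0 hρtri`) dominating `|x|₁` between the entry's end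
  positions `p₁ ∕ p₂` (`hd`), lattice sums `hV ≤ VK`; ONE run-A three-factor datum `(uA, CA, vA)` over histories `v : Fin (k+1) → ℝ` factorising `Π^{(K)}_{k+1,μν}(v; x)` eventually in `K`
  on the record's boxes (`hA`) and a run-B datum `(uB, CB, vB)` over `w : Fin (k+2) → ℝ` factorising `Π^{(K + s F θ)}_{k+2,μν}(w; x)` (`hB`); k-UNIFORM sizes `hu hCA hvA hCB hvB ≤ sA, sC, sB`;
  ONE-LINE RATES `hdu hdC hdv ≤ cA·θK^{k+1}, cC·θK^{k+1}, cB·θK^{k+1}` between run B at `w` and run A at `Fin.tail w`; signs `hks`; ONE domination row `hdom : (ℓ F θ).κ ≤ κK∕2 ∧ θK ≤ (ℓ F θ).θ₅ ∧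
  ((cA·sC·sB + sA·cC·sB + sA·sC·cB)·VK²)·θK ≤ (ℓ F θ).C₅·(ℓ F θ).θ₅` ⟹ the bill's two guarded rows `hS : WindowedStepRateOfRecord₁₃ F N θ' (s F θ) (ℓ F θ).κ (ℓ F θ).θ₅ ((ℓ F θ).C₅ * (ℓ F θ).θ₅)` and
  `hW : WindowedDecayOfRecord₁₃ F N θ' 0 1 (ℓ F θ).κ` (`θ' := θ.toStage13Params`).  The SAME run-A datum serves both rows: the step producer's run-A slots are fed `fun K k w ↦ uA F θ K k (Fin.tail w)`
  and its joint eventual factorisation is `hA (Fin.tail w)` ∧ᶠ `hB w` (`Fin.tail w ∈ ]0, γ]^{k+1}` for `w ∈ ]0, γ]^{k+2}`: `T4FlagMemory.tail_mem_box`, BY NAME).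
* §1 ★★★ `spine_rec13CCoPHOn_of_v5pins_fsc_at_crOfRecord₁₃VAt_cut_of_kingMechanism` — APF §1 `…_of_finiteVolumeLetters` with `hS hW ⟸ §0`: any regime `Rg`.  Displayed: the four pins
  `hpin1 hpin2 hpinL hpin` · `h16` · `hs hκ hcr hρ` · THREE finite-volume kernel rows `hr hinc h9` · the SIXTEEN King rows · `hsel hζm` · keyed `h20 h21` · FSC `h19` at the spelled `PHolderD4 β`.
* §2 ★★★ `spine_rec13CCoPHOn_live_of_v5pins_fsc_at_crOfRecord₁₃VAt_cut_of_kingMechanism` — §1 ON THE LIVE LINE of a regime `G` (`Rg := G ∧ LiveSel` spelled `N`-generically; `hsel := hRg.2`).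
Consumed BY NAME: APF §1 (gen 13; through it AP §1, UC4, UC §0, dag-n20-d transfers, dag-n19-w3's FSC composer, (Kꜰ) §1, dag-n18-w2's finite-volume door `u3KernelInputs_of_finiteVolumeLetters`
p606911); dag-n18-w4 FILE 3 §6 (p608767; through it FILE 1 p606901's mechanism `kernelStepRate∕windowedStepRate_of_threeFactorRates`, p415038's `bilin3_rate ∕ bilin_decay_bound`, dag-n22-w2's
`windowedDecay_of_le`); pins and faces of dag-n14-w1 ∕ dag-n15-a ∕ dag-n16-e as in APF.  Nothing landed is edited or re-declared.

HONEST FRAMING.  COMPOSITE-node bookkeeping BY NAME; a REDUCTION, not a discharge.  KING's ROWS ARE HYPOTHESES: the three-factor structure `u ⬝ (E v)` of Bałaban's windowed (1.20)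
kernels over a summation lattice, the k-UNIFORM sizes, the one-line rates `c·θK^{k+1}` and the lattice sums ARE the N18 ∕ (D4) estimate — C. King's printed MODEL of the mechanism
([King1986] Prop. 3.9 (3.73) p. 665 «the error is the same graph with a difference of propagators on one line … Proposition 3.8 gives the desired factor L^{−γk}», (4.42)–(4.43) p. 675)
typed by dag-n18-w4 for Bałaban's vacuum-polarisation kernels; for d = 4 Yang–Mills NOT PRINTED ([Balaban1987RG1] Thm 1 p. 259 prints uniformity in the spacing only) and proved
nowhere in the tree.  Every other displayed antecedent is a HYPOTHESIS inhabited for no family today (K0⁷ `Record13SepCoPHInhabited` OPEN) or a decided MODEL behind a pin; pins are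
hypotheses on a FREE reading `𝔯` (no reading minted); `jc sh ℓ s r ℓ₃ B 𝔯 β` and ALL King data ∕ letters are FREE PARAMETERS; nothing of Bałaban's or King's asserted or instantiated;
NOT `stub_rates13H` ∕ `stub_expansion13H`; N14–N22 ∕ N27 NOT discharged (the chair books, R417); K3⁷ OPEN, NOT claimed; skeleton v5 untouched; counts UNMOVED (typed 28∕28 ·
discharged 5∕27, A 5∕28); one finite four-torus programme at fixed `ε` — NOT ℝ⁴, NOT infinite volume, NOT OS, NOT a mass gap, NOT Clay.  No decl below carries a cite tag.
-/

set_option autoImplicit false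

namespace Summit.QuantumFields.YangMills.Theorems.BalabanUVNodesN27SpineRecord

open scoped BigOperators Matrix.Norms.L2Operator
open Literature.MathematicalPhysics.QuantumFieldTheory.Balaban1983to89
open Literature.MathematicalPhysics.QuantumFieldTheory.Balaban1983to89.T4Continuum
open Literature.MathematicalPhysics.QuantumFieldTheory.Balaban1983to89.Node00
open Literature.MathematicalPhysics.QuantumFieldTheory.Balaban1983to89.B12Sec2to5 (betaPrime510 l1)
open Literature.MathematicalPhysics.QuantumFieldTheory.Balaban1983to89.FlowStep (Box)
open Literature.MathematicalPhysics.QuantumFieldTheory.Balaban1983to89.Node00.U3OfKernels (objectsOfRecord₁₃ KernelDecayOfRecord₁₃)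
open Literature.MathematicalPhysics.QuantumFieldTheory.Balaban1983to89.Node00.U3KernelLetters (GeometricIncrementsOfRecord₁₃ WindowedNE9OfRecord₁₃ WindowedDecayOfRecord₁₃
  WindowedStepRateOfRecord₁₃)
open T4WeightBudget (RelWeightBound)
open T4IndicatorShell (ShellWeightBound)
open T4ContinuumYM4Torus (ForSmallCouplings)
open Summit.QuantumFields.BalabanUV.T4Continuum.Spine
open YMDAG.UVSplit
open Summit.QuantumFields.BalabanUV.T4Continuum.MinimalActionRate (sfClass)
open Summit.QuantumFields.YangMills.BalabanUVNodes.N19TargetClassWeightsE1Keyed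
open Summit.QuantumFields.YangMills.BalabanUVNodes.N16HolderDefs (N16HolderAt)
open Summit.QuantumFields.YangMills.BalabanUVNodes.SpineRatesHolder (RatesHolderAt)
open YMDAG.N14.TopBorn (Ne1PinnedOfRecord n14At_rateCarriersOfRecord₁₃CoPH_of_pinned)
open Summit.QuantumFields.YangMills.BalabanUVNodes.N15.GenuineRecord (fullGSizedObjects n15At_fullGSizedObjects_family)
open Summit.QuantumFields.YangMills.BalabanUVNodes.N15.AtKeyedHome (neZero_blockFactor)
open Summit.QuantumFields.YangMills.BalabanUVNodes.N16PinnedLayer13CoPH (N16PinnedLoose rateCarriers_ne3_of_pinnedLoose)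
open YMDAG.N18.KernelStepRateKingMechanism (windowedStepRateOfRecord₁₃_of_threeFactorRates windowedStepRateOfRecord₁₃_mono windowedDecayOfRecord₁₃_of_threeFactorSizes
  windowedDecayOfRecord₁₃_anti)
open Matrix Filter

variable {N : ℕ} [NeZero N] (K₀ : ℕ)
  (jc : (F : T4Family) → (θ : Stage13HParams F N) → θ.Provisos₁₃CoPH F N → (ℕ → ℝ) → List (ULoop F) → ℕ → ℕ)
  (sh : ShellSplit₁₃CoPH N K₀) (β : ℝ) (𝔯 : RateReading₁₃CoPH N)
  (ksel : (F : T4Family) → (θ : Stage13HParams F N) → θ.Provisos₁₃CoPH F N → (ℕ → ℝ) → List (ULoop F) → ℕ)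
  (ℓ : (F : T4Family) → Stage13HParams F N → U3Letters₁₁) (s : (F : T4Family) → Stage13HParams F N → ℕ) (r : (F : T4Family) → Stage13HParams F N → ℝ)
  (ℓ₃ : T4Family → NE3Letters₁₁) (B : T4Family → ℝ)

-- KING's three-factor data at the record's windowed kernels (dag-n18-w4 FILE 3 §6), `(F, θ)`-dependent; `K` = volume index, `k` = level
variable {PK : (F : T4Family) → Stage13HParams F N → ℕ → ℕ → Type*} {βK : (F : T4Family) → Stage13HParams F N → ℕ → ℕ → Type*}
  [∀ F θ K k, Fintype (βK F θ K k)]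
  (ρd : (F : T4Family) → (θ : Stage13HParams F N) → (K k : ℕ) → PK F θ K k → PK F θ K k → ℝ)
  (q : (F : T4Family) → (θ : Stage13HParams F N) → (K k : ℕ) → βK F θ K k → PK F θ K k)
  (p₁ p₂ : (F : T4Family) → (θ : Stage13HParams F N) → (K k : ℕ) → Fin 4 → Fin 4 → (Fin 4 → ℤ) → PK F θ K k)
  (uA vA : (F : T4Family) → (θ : Stage13HParams F N) → (K k : ℕ) → (Fin (k + 1) → ℝ) → Fin 4 → Fin 4 → (Fin 4 → ℤ) → βK F θ K k → ℝ)
  (CA : (F : T4Family) → (θ : Stage13HParams F N) → (K k : ℕ) → (Fin (k + 1) → ℝ) → Fin 4 → Fin 4 → (Fin 4 → ℤ) → Matrix (βK F θ K k) (βK F θ K k) ℝ)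
  (uB vB : (F : T4Family) → (θ : Stage13HParams F N) → (K k : ℕ) → (Fin (k + 2) → ℝ) → Fin 4 → Fin 4 → (Fin 4 → ℤ) → βK F θ K k → ℝ)
  (CB : (F : T4Family) → (θ : Stage13HParams F N) → (K k : ℕ) → (Fin (k + 2) → ℝ) → Fin 4 → Fin 4 → (Fin 4 → ℤ) → Matrix (βK F θ K k) (βK F θ K k) ℝ)
  (κK θK VK sA sC sB cA cC cB : (F : T4Family) → Stage13HParams F N → ℝ)

/-! ## §0 KING's MECHANISM ROWS ⟹ the bill's two windowed rows of record `hS` (N18) and `hW` ((D4)), per regime (dag-n18-w4 FILE 3 §6 + its monotonicity faces, BY NAME) -/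


/-- ★★ **THE N18 ROW `hS` AND THE (D4) ROW `hW` OF THE v5 BILL FROM KING's THREE-FACTOR MECHANISM ON THE RECORD's WINDOWED KERNELS, PER REGIME** (dag-n18-w4 FILE 3 §6 BY NAME:
`windowedStepRateOfRecord₁₃_of_threeFactorRates` — run-A slots fed `fun K k w ↦ uA F θ K k (Fin.tail w)` etc., joint eventual factorisation `hA (Fin.tail w)` ∧ᶠ `hB w` — then
`windowedStepRateOfRecord₁₃_mono` at the domination row (`0 ≤ (ℓ F θ).C₅ * (ℓ F θ).θ₅` by `Signs`); `windowedDecayOfRecord₁₃_of_threeFactorSizes … 0 1` on the run-A datum then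
`windowedDecayOfRecord₁₃_anti`).  Every King row is a HYPOTHESIS — the three-factor structure ∕ k-uniform sizes ∕ one-line rates ∕ lattice sums of Bałaban's windowed (1.20) kernels ARE
the estimate ([King1986] p. 665, (4.42)–(4.43) p. 675 typed; NOT PRINTED for d = 4; proved nowhere); N18 ∕ (D4) NOT discharged. [bookkeeping] -/
theorem windowedRowsOfRecord₁₃_guarded_of_kingMechanism (Rg : (F : T4Family) → Stage13HParams F N → Prop)
    (hs : ∀ (F : T4Family) (θ : Stage13HParams F N), θ.Provisos₁₃CoPH F N → Rg F θ → θ.Admissible F N → (ℓ F θ).Signs)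
    (hks : ∀ (F : T4Family) (θ : Stage13HParams F N), θ.Provisos₁₃CoPH F N → Rg F θ → θ.Admissible F N →
      0 ≤ κK F θ ∧ 0 ≤ θK F θ ∧ 0 ≤ sA F θ ∧ 0 ≤ sC F θ ∧ 0 ≤ sB F θ ∧ 0 ≤ cA F θ ∧ 0 ≤ cC F θ ∧ 0 ≤ cB F θ)
    (hρ0 : ∀ (F : T4Family) (θ : Stage13HParams F N) (K k : ℕ) (t t' : PK F θ K k), 0 ≤ ρd F θ K k t t')
    (hρtri : ∀ (F : T4Family) (θ : Stage13HParams F N) (K k : ℕ) (t t' t'' : PK F θ K k), ρd F θ K k t t'' ≤ ρd F θ K k t t' + ρd F θ K k t' t'')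
    (hd : ∀ (F : T4Family) (θ : Stage13HParams F N) (K k : ℕ) (μ ν : Fin 4) (x : Fin 4 → ℤ), l1 x ≤ ρd F θ K k (p₁ F θ K k μ ν x) (p₂ F θ K k μ ν x))
    (hV : ∀ (F : T4Family) (θ : Stage13HParams F N), θ.Provisos₁₃CoPH F N → Rg F θ → θ.Admissible F N →
      ∀ (K k : ℕ) (t : PK F θ K k), ∑ i, Real.exp (-(κK F θ / 2 * ρd F θ K k t (q F θ K k i))) ≤ VK F θ)
    (hA : ∀ (F : T4Family) (θ : Stage13HParams F N), θ.Provisos₁₃CoPH F N → Rg F θ → θ.Admissible F N →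
      (letI := θ.instVβ₁; letI := θ.instVβ₂; letI := θ.instιβ
      ∀ (k : ℕ) (v : Fin (k + 1) → ℝ), v ∈ Box θ.γ k → ∀ (μ ν : Fin 4) (x : Fin 4 → ℤ), ∀ᶠ K in atTop,
        polWindow F K (k + 1) (mergedTermFamilyMatT F N (TβOfRecord₁₃ F N) (chiβOfRecord₁₃ F N θ.toStage13Params) θ.εbg k v K) θ.ρ8 θ.bV μ ν x =
          uA F θ K k v μ ν x ⬝ᵥ (CA F θ K k v μ ν x *ᵥ vA F θ K k v μ ν x)))
    (hB : ∀ (F : T4Family) (θ : Stage13HParams F N), θ.Provisos₁₃CoPH F N → Rg F θ → θ.Admissible F N →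
      (letI := θ.instVβ₁; letI := θ.instVβ₂; letI := θ.instιβ
      ∀ (k : ℕ) (w : Fin (k + 2) → ℝ), w ∈ Box θ.γ (k + 1) → ∀ (μ ν : Fin 4) (x : Fin 4 → ℤ), ∀ᶠ K in atTop,
        polWindow F (K + s F θ) (k + 1 + 1) (mergedTermFamilyMatT F N (TβOfRecord₁₃ F N) (chiβOfRecord₁₃ F N θ.toStage13Params) θ.εbg (k + 1) w (K + s F θ)) θ.ρ8 θ.bV μ ν x =
          uB F θ K k w μ ν x ⬝ᵥ (CB F θ K k w μ ν x *ᵥ vB F θ K k w μ ν x)))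
    (hu : ∀ (F : T4Family) (θ : Stage13HParams F N), θ.Provisos₁₃CoPH F N → Rg F θ → θ.Admissible F N →
      ∀ (K k : ℕ) (v : Fin (k + 1) → ℝ) (μ ν : Fin 4) (x : Fin 4 → ℤ) (i : βK F θ K k),
        |uA F θ K k v μ ν x i| ≤ sA F θ * Real.exp (-(κK F θ * ρd F θ K k (p₁ F θ K k μ ν x) (q F θ K k i))))
    (hCA : ∀ (F : T4Family) (θ : Stage13HParams F N), θ.Provisos₁₃CoPH F N → Rg F θ → θ.Admissible F N →
      ∀ (K k : ℕ) (v : Fin (k + 1) → ℝ) (μ ν : Fin 4) (x : Fin 4 → ℤ) (i i' : βK F θ K k),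
        |CA F θ K k v μ ν x i i'| ≤ sC F θ * Real.exp (-(κK F θ * ρd F θ K k (q F θ K k i) (q F θ K k i'))))
    (hvA : ∀ (F : T4Family) (θ : Stage13HParams F N), θ.Provisos₁₃CoPH F N → Rg F θ → θ.Admissible F N →
      ∀ (K k : ℕ) (v : Fin (k + 1) → ℝ) (μ ν : Fin 4) (x : Fin 4 → ℤ) (i' : βK F θ K k),
        |vA F θ K k v μ ν x i'| ≤ sB F θ * Real.exp (-(κK F θ * ρd F θ K k (q F θ K k i') (p₂ F θ K k μ ν x))))
    (hCB : ∀ (F : T4Family) (θ : Stage13HParams F N), θ.Provisos₁₃CoPH F N → Rg F θ → θ.Admissible F N →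
      ∀ (K k : ℕ) (w : Fin (k + 2) → ℝ) (μ ν : Fin 4) (x : Fin 4 → ℤ) (i i' : βK F θ K k),
        |CB F θ K k w μ ν x i i'| ≤ sC F θ * Real.exp (-(κK F θ * ρd F θ K k (q F θ K k i) (q F θ K k i'))))
    (hvB : ∀ (F : T4Family) (θ : Stage13HParams F N), θ.Provisos₁₃CoPH F N → Rg F θ → θ.Admissible F N →
      ∀ (K k : ℕ) (w : Fin (k + 2) → ℝ) (μ ν : Fin 4) (x : Fin 4 → ℤ) (i' : βK F θ K k),
        |vB F θ K k w μ ν x i'| ≤ sB F θ * Real.exp (-(κK F θ * ρd F θ K k (q F θ K k i') (p₂ F θ K k μ ν x))))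
    (hdu : ∀ (F : T4Family) (θ : Stage13HParams F N), θ.Provisos₁₃CoPH F N → Rg F θ → θ.Admissible F N →
      ∀ (K k : ℕ) (w : Fin (k + 2) → ℝ) (μ ν : Fin 4) (x : Fin 4 → ℤ) (i : βK F θ K k),
        |uB F θ K k w μ ν x i - uA F θ K k (Fin.tail w) μ ν x i| ≤
          cA F θ * θK F θ ^ (k + 1) * Real.exp (-(κK F θ * ρd F θ K k (p₁ F θ K k μ ν x) (q F θ K k i))))
    (hdC : ∀ (F : T4Family) (θ : Stage13HParams F N), θ.Provisos₁₃CoPH F N → Rg F θ → θ.Admissible F N →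
      ∀ (K k : ℕ) (w : Fin (k + 2) → ℝ) (μ ν : Fin 4) (x : Fin 4 → ℤ) (i i' : βK F θ K k),
        |CB F θ K k w μ ν x i i' - CA F θ K k (Fin.tail w) μ ν x i i'| ≤
          cC F θ * θK F θ ^ (k + 1) * Real.exp (-(κK F θ * ρd F θ K k (q F θ K k i) (q F θ K k i'))))
    (hdv : ∀ (F : T4Family) (θ : Stage13HParams F N), θ.Provisos₁₃CoPH F N → Rg F θ → θ.Admissible F N →
      ∀ (K k : ℕ) (w : Fin (k + 2) → ℝ) (μ ν : Fin 4) (x : Fin 4 → ℤ) (i' : βK F θ K k),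
        |vB F θ K k w μ ν x i' - vA F θ K k (Fin.tail w) μ ν x i'| ≤
          cB F θ * θK F θ ^ (k + 1) * Real.exp (-(κK F θ * ρd F θ K k (q F θ K k i') (p₂ F θ K k μ ν x))))
    (hdom : ∀ (F : T4Family) (θ : Stage13HParams F N), θ.Provisos₁₃CoPH F N → Rg F θ → θ.Admissible F N →
      (ℓ F θ).κ ≤ κK F θ / 2 ∧ θK F θ ≤ (ℓ F θ).θ₅ ∧
        ((cA F θ * sC F θ * sB F θ + sA F θ * cC F θ * sB F θ + sA F θ * sC F θ * cB F θ) * VK F θ ^ 2) * θK F θ ≤ (ℓ F θ).C₅ * (ℓ F θ).θ₅) :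
    (∀ (F : T4Family) (θ : Stage13HParams F N), θ.Provisos₁₃CoPH F N → Rg F θ → θ.Admissible F N →
      WindowedStepRateOfRecord₁₃ F N θ.toStage13Params (s F θ) (ℓ F θ).κ (ℓ F θ).θ₅ ((ℓ F θ).C₅ * (ℓ F θ).θ₅)) ∧
    (∀ (F : T4Family) (θ : Stage13HParams F N), θ.Provisos₁₃CoPH F N → Rg F θ → θ.Admissible F N →
      WindowedDecayOfRecord₁₃ F N θ.toStage13Params 0 1 (ℓ F θ).κ) := by
  refine ⟨fun F θ hP hRg hθ => ?_, fun F θ hP hRg hθ => ?_⟩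
  · obtain ⟨hκ0, hθ0, hsA0, hsC0, hsB0, hcA0, hcC0, hcB0⟩ := hks F θ hP hRg hθ
    obtain ⟨hkκ, hkθ, hkC⟩ := hdom F θ hP hRg hθ
    exact windowedStepRateOfRecord₁₃_mono F N θ.toStage13Params
      (windowedStepRateOfRecord₁₃_of_threeFactorRates F N θ.toStage13Params (s F θ) (ρd F θ) (hρ0 F θ) (hρtri F θ) (q F θ) (p₁ F θ) (p₂ F θ)
        (fun K k w => uA F θ K k (Fin.tail w)) (fun K k w => vA F θ K k (Fin.tail w)) (uB F θ) (vB F θ) (fun K k w => CA F θ K k (Fin.tail w)) (CB F θ)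
        hκ0 hθ0 hsA0 hsC0 hsB0 hcA0 hcC0 hcB0
        (fun k w hw μ ν x => (hA F θ hP hRg hθ k (Fin.tail w) (T4FlagMemory.tail_mem_box hw) μ ν x).and (hB F θ hP hRg hθ k w hw μ ν x))
        (fun K k w => hu F θ hP hRg hθ K k (Fin.tail w)) (fun K k w => hCA F θ hP hRg hθ K k (Fin.tail w)) (hCB F θ hP hRg hθ) (hvB F θ hP hRg hθ)
        (hdu F θ hP hRg hθ) (hdC F θ hP hRg hθ) (hdv F θ hP hRg hθ) (hV F θ hP hRg hθ) (hd F θ))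
      hkκ hθ0 hkθ hkC (mul_nonneg (hs F θ hP hRg hθ).C₅_nonneg (hs F θ hP hRg hθ).θ₅_pos.le)
  · obtain ⟨hκ0, -, hsA0, hsC0, hsB0, -⟩ := hks F θ hP hRg hθ
    exact windowedDecayOfRecord₁₃_anti F N θ.toStage13Params
      (windowedDecayOfRecord₁₃_of_threeFactorSizes F N θ.toStage13Params (ρd F θ) (hρ0 F θ) (hρtri F θ) (q F θ) (p₁ F θ) (p₂ F θ) (uA F θ) (vA F θ) (CA F θ)
        hκ0 hsA0 hsC0 hsB0 (hA F θ hP hRg hθ) (hu F θ hP hRg hθ) (hCA F θ hP hRg hθ) (hvA F θ hP hRg hθ) (hV F θ hP hRg hθ) (hd F θ) 0 1)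
      (hdom F θ hP hRg hθ).1

/-! ## §1 All four v5 reading pins + the spine pin, any regime; u3 block = THREE finite-volume letters `hr hinc h9` + KING's MECHANISM ROWS for `hS`∕`hW` -/

/-- ★★★ **N27 = B5 AT THE REGIME RECORD CLASS FROM A READING CARRYING ALL FOUR v5 PINS, K5 AT THE PER-TUPLE-CUT SPINE READING OF RECORD — KING-MECHANISM EDITION**
(APF §1 `spine_rec13CCoPHOn_of_v5pins_fsc_at_crOfRecord₁₃VAt_cut_of_finiteVolumeLetters` with its N18 row `hS : WindowedStepRateOfRecord₁₃ …` and its (D4) row `hW :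
WindowedDecayOfRecord₁₃ … 0 1 …` SUPPLIED by §0 from King's three-factor mechanism rows on the record's windowed kernels — dag-n18-w4 FILE 3 §6 BY NAME).  Displayed: the four pins ·
`h16` · `hs hκ hcr hρ` · `hr hinc h9` · the sixteen King rows `hks hρ0 hρtri hd hV hA hB hu hCA hvA hCB hvB hdu hdC hdv hdom` · `hsel hζm` · keyed `h20 h21` · FSC `h19` at the spelled
`PHolderD4 β`.  Every row a HYPOTHESIS or a decided MODEL (0∕1 today); King's rows ARE the N18 ∕ (D4) estimate, NOT PRINTED for d = 4; nothing proved of Bałaban's or King's; NOT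
`stub_rates13H` ∕ `stub_expansion13H`; no node discharged. [bookkeeping] -/
theorem spine_rec13CCoPHOn_of_v5pins_fsc_at_crOfRecord₁₃VAt_cut_of_kingMechanism (Rg : (F : T4Family) → Stage13HParams F N → Prop)
    (hpin1 : Ne1PinnedOfRecord 𝔯)
    (hpin2 : ∃ (b aS : ℝ) (ν μ α β' : Fin 4) (c35 p : ℝ), 0 < b ∧ 0 < aS ∧
      ∀ (F : T4Family) (θ : Stage13HParams F N) (hP : θ.Provisos₁₃CoPH F N) (g₀ : ℕ → ℝ) (os : List (ULoop F)) (k : ℕ),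
        (𝔯.lit F θ hP g₀ os).ne2 k = haveI := neZero_blockFactor F; fullGSizedObjects 3 F.hL b aS ν μ α β' c35 p)
    (hpinL : N16PinnedLoose 𝔯 ℓ₃ B)
    (hpin : ∀ (F : T4Family) (θ : Stage13HParams F N) (hP : θ.Provisos₁₃CoPH F N) (g₀ : ℕ → ℝ) (os : List (ULoop F)),
      (𝔯.lit F θ hP g₀ os).u3 = objectsOfRecord₁₃ F N θ.toStage13Params (ℓ F θ))
    (h16 : ∀ (F : T4Family), (∃ θ : Stage13HParams F N, θ.Provisos₁₃CoPH F N ∧ Rg F θ ∧ θ.Admissible F N) →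
      N16HolderAt (ne3OfRecord₁₁ F { ne3ConstLayerOfRecord₁₁ F N (ℓ₃ F) with
        dom := {V | V ∈ ne3DomOfRecord₁₁ F N 0 0 ∧ V ∈ sfClass 4 F.L (ne3NperOfRecord₁₁ F 0 0) ((ℓ₃ F).ε / B F) 0} }) β)
    (hs : ∀ (F : T4Family) (θ : Stage13HParams F N), θ.Provisos₁₃CoPH F N → Rg F θ → θ.Admissible F N → (ℓ F θ).Signs)
    (hκ : ∀ (F : T4Family) (θ : Stage13HParams F N), θ.Provisos₁₃CoPH F N → Rg F θ → θ.Admissible F N → 0 < (ℓ F θ).κ)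
    (hcr : ∀ (F : T4Family) (θ : Stage13HParams F N), θ.Provisos₁₃CoPH F N → Rg F θ → θ.Admissible F N →
      betaPrime510 4 1 (ℓ F θ).κ ≤ (ℓ F θ).cr)
    (hρ : ∀ (F : T4Family) (θ : Stage13HParams F N), θ.Provisos₁₃CoPH F N → Rg F θ → θ.Admissible F N →
      0 ≤ (ℓ F θ).ρ ∧ (ℓ F θ).ρ < 1)
    (hr : ∀ (F : T4Family) (θ : Stage13HParams F N), θ.Provisos₁₃CoPH F N → Rg F θ → θ.Admissible F N → r F θ < 1)
    (hinc : ∀ (F : T4Family) (θ : Stage13HParams F N), θ.Provisos₁₃CoPH F N → Rg F θ → θ.Admissible F N →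
      GeometricIncrementsOfRecord₁₃ F N θ.toStage13Params (r F θ))
    (h9 : ∀ (F : T4Family) (θ : Stage13HParams F N), θ.Provisos₁₃CoPH F N → Rg F θ → θ.Admissible F N →
      WindowedNE9OfRecord₁₃ F N θ.toStage13Params (ℓ F θ).κ (ℓ F θ).moduli)
    (hks : ∀ (F : T4Family) (θ : Stage13HParams F N), θ.Provisos₁₃CoPH F N → Rg F θ → θ.Admissible F N →
      0 ≤ κK F θ ∧ 0 ≤ θK F θ ∧ 0 ≤ sA F θ ∧ 0 ≤ sC F θ ∧ 0 ≤ sB F θ ∧ 0 ≤ cA F θ ∧ 0 ≤ cC F θ ∧ 0 ≤ cB F θ)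
    (hρ0 : ∀ (F : T4Family) (θ : Stage13HParams F N) (K k : ℕ) (t t' : PK F θ K k), 0 ≤ ρd F θ K k t t')
    (hρtri : ∀ (F : T4Family) (θ : Stage13HParams F N) (K k : ℕ) (t t' t'' : PK F θ K k), ρd F θ K k t t'' ≤ ρd F θ K k t t' + ρd F θ K k t' t'')
    (hd : ∀ (F : T4Family) (θ : Stage13HParams F N) (K k : ℕ) (μ ν : Fin 4) (x : Fin 4 → ℤ), l1 x ≤ ρd F θ K k (p₁ F θ K k μ ν x) (p₂ F θ K k μ ν x))
    (hV : ∀ (F : T4Family) (θ : Stage13HParams F N), θ.Provisos₁₃CoPH F N → Rg F θ → θ.Admissible F N →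
      ∀ (K k : ℕ) (t : PK F θ K k), ∑ i, Real.exp (-(κK F θ / 2 * ρd F θ K k t (q F θ K k i))) ≤ VK F θ)
    (hA : ∀ (F : T4Family) (θ : Stage13HParams F N), θ.Provisos₁₃CoPH F N → Rg F θ → θ.Admissible F N →
      (letI := θ.instVβ₁; letI := θ.instVβ₂; letI := θ.instιβ
      ∀ (k : ℕ) (v : Fin (k + 1) → ℝ), v ∈ Box θ.γ k → ∀ (μ ν : Fin 4) (x : Fin 4 → ℤ), ∀ᶠ K in atTop,
        polWindow F K (k + 1) (mergedTermFamilyMatT F N (TβOfRecord₁₃ F N) (chiβOfRecord₁₃ F N θ.toStage13Params) θ.εbg k v K) θ.ρ8 θ.bV μ ν x =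
          uA F θ K k v μ ν x ⬝ᵥ (CA F θ K k v μ ν x *ᵥ vA F θ K k v μ ν x)))
    (hB : ∀ (F : T4Family) (θ : Stage13HParams F N), θ.Provisos₁₃CoPH F N → Rg F θ → θ.Admissible F N →
      (letI := θ.instVβ₁; letI := θ.instVβ₂; letI := θ.instιβ
      ∀ (k : ℕ) (w : Fin (k + 2) → ℝ), w ∈ Box θ.γ (k + 1) → ∀ (μ ν : Fin 4) (x : Fin 4 → ℤ), ∀ᶠ K in atTop,
        polWindow F (K + s F θ) (k + 1 + 1) (mergedTermFamilyMatT F N (TβOfRecord₁₃ F N) (chiβOfRecord₁₃ F N θ.toStage13Params) θ.εbg (k + 1) w (K + s F θ)) θ.ρ8 θ.bV μ ν x =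
          uB F θ K k w μ ν x ⬝ᵥ (CB F θ K k w μ ν x *ᵥ vB F θ K k w μ ν x)))
    (hu : ∀ (F : T4Family) (θ : Stage13HParams F N), θ.Provisos₁₃CoPH F N → Rg F θ → θ.Admissible F N →
      ∀ (K k : ℕ) (v : Fin (k + 1) → ℝ) (μ ν : Fin 4) (x : Fin 4 → ℤ) (i : βK F θ K k),
        |uA F θ K k v μ ν x i| ≤ sA F θ * Real.exp (-(κK F θ * ρd F θ K k (p₁ F θ K k μ ν x) (q F θ K k i))))
    (hCA : ∀ (F : T4Family) (θ : Stage13HParams F N), θ.Provisos₁₃CoPH F N → Rg F θ → θ.Admissible F N →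
      ∀ (K k : ℕ) (v : Fin (k + 1) → ℝ) (μ ν : Fin 4) (x : Fin 4 → ℤ) (i i' : βK F θ K k),
        |CA F θ K k v μ ν x i i'| ≤ sC F θ * Real.exp (-(κK F θ * ρd F θ K k (q F θ K k i) (q F θ K k i'))))
    (hvA : ∀ (F : T4Family) (θ : Stage13HParams F N), θ.Provisos₁₃CoPH F N → Rg F θ → θ.Admissible F N →
      ∀ (K k : ℕ) (v : Fin (k + 1) → ℝ) (μ ν : Fin 4) (x : Fin 4 → ℤ) (i' : βK F θ K k),
        |vA F θ K k v μ ν x i'| ≤ sB F θ * Real.exp (-(κK F θ * ρd F θ K k (q F θ K k i') (p₂ F θ K k μ ν x))))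
    (hCB : ∀ (F : T4Family) (θ : Stage13HParams F N), θ.Provisos₁₃CoPH F N → Rg F θ → θ.Admissible F N →
      ∀ (K k : ℕ) (w : Fin (k + 2) → ℝ) (μ ν : Fin 4) (x : Fin 4 → ℤ) (i i' : βK F θ K k),
        |CB F θ K k w μ ν x i i'| ≤ sC F θ * Real.exp (-(κK F θ * ρd F θ K k (q F θ K k i) (q F θ K k i'))))
    (hvB : ∀ (F : T4Family) (θ : Stage13HParams F N), θ.Provisos₁₃CoPH F N → Rg F θ → θ.Admissible F N →
      ∀ (K k : ℕ) (w : Fin (k + 2) → ℝ) (μ ν : Fin 4) (x : Fin 4 → ℤ) (i' : βK F θ K k),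
        |vB F θ K k w μ ν x i'| ≤ sB F θ * Real.exp (-(κK F θ * ρd F θ K k (q F θ K k i') (p₂ F θ K k μ ν x))))
    (hdu : ∀ (F : T4Family) (θ : Stage13HParams F N), θ.Provisos₁₃CoPH F N → Rg F θ → θ.Admissible F N →
      ∀ (K k : ℕ) (w : Fin (k + 2) → ℝ) (μ ν : Fin 4) (x : Fin 4 → ℤ) (i : βK F θ K k),
        |uB F θ K k w μ ν x i - uA F θ K k (Fin.tail w) μ ν x i| ≤
          cA F θ * θK F θ ^ (k + 1) * Real.exp (-(κK F θ * ρd F θ K k (p₁ F θ K k μ ν x) (q F θ K k i))))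
    (hdC : ∀ (F : T4Family) (θ : Stage13HParams F N), θ.Provisos₁₃CoPH F N → Rg F θ → θ.Admissible F N →
      ∀ (K k : ℕ) (w : Fin (k + 2) → ℝ) (μ ν : Fin 4) (x : Fin 4 → ℤ) (i i' : βK F θ K k),
        |CB F θ K k w μ ν x i i' - CA F θ K k (Fin.tail w) μ ν x i i'| ≤
          cC F θ * θK F θ ^ (k + 1) * Real.exp (-(κK F θ * ρd F θ K k (q F θ K k i) (q F θ K k i'))))
    (hdv : ∀ (F : T4Family) (θ : Stage13HParams F N), θ.Provisos₁₃CoPH F N → Rg F θ → θ.Admissible F N →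
      ∀ (K k : ℕ) (w : Fin (k + 2) → ℝ) (μ ν : Fin 4) (x : Fin 4 → ℤ) (i' : βK F θ K k),
        |vB F θ K k w μ ν x i' - vA F θ K k (Fin.tail w) μ ν x i'| ≤
          cB F θ * θK F θ ^ (k + 1) * Real.exp (-(κK F θ * ρd F θ K k (q F θ K k i') (p₂ F θ K k μ ν x))))
    (hdom : ∀ (F : T4Family) (θ : Stage13HParams F N), θ.Provisos₁₃CoPH F N → Rg F θ → θ.Admissible F N →
      (ℓ F θ).κ ≤ κK F θ / 2 ∧ θK F θ ≤ (ℓ F θ).θ₅ ∧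
        ((cA F θ * sC F θ * sB F θ + sA F θ * cC F θ * sB F θ + sA F θ * sC F θ * cB F θ) * VK F θ ^ 2) * θK F θ ≤ (ℓ F θ).C₅ * (ℓ F θ).θ₅)
    (hsel : ∀ (F : T4Family) (θ : Stage13HParams F N), θ.Provisos₁₃CoPH F N → Rg F θ → θ.Admissible F N →
      ∃ E : B12.RunParams → ℝ, θ.ppSel = ppSelLiveOfRecord F N θ.ν θ.τ9 E (wOfRecord₉ F N θ.toStage9Params))
    (hζm : ∀ (F : T4Family) (θ : Stage13HParams F N), θ.Provisos₁₃CoPH F N → Rg F θ → θ.Admissible F N → ZetaMeasurable F N θ.ζ)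
    (h20 : ∀ (F : T4Family) (θ : Stage13HParams F N) (hP : θ.Provisos₁₃CoPH F N), Rg F θ → θ.Admissible F N →
      ∀ (g₀ : ℕ → ℝ) (os : List (ULoop F)),
        ∃ W : ℕ → ℝ, RelWeightBound 1 (classSet₁₃ θ K₀ g₀) (weightA₁₃ θ hP K₀ g₀ os) (weightB₁₃ θ hP K₀ g₀ os) (badClass₁₃ θ K₀ g₀ (jc F θ hP g₀ os)) W)
    (h21 : ∀ (F : T4Family) (θ : Stage13HParams F N) (hP : θ.Provisos₁₃CoPH F N), Rg F θ → θ.Admissible F N →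
      ∀ (g₀ : ℕ → ℝ) (os : List (ULoop F)),
        ∃ Wsh : ℕ → ℝ, ShellWeightBound 1 (classSet₁₃ θ K₀ g₀) (weightA₁₃ θ hP K₀ g₀ os) (weightB₁₃ θ hP K₀ g₀ os) (sh F θ hP g₀ os).1 (sh F θ hP g₀ os).2 Wsh)
    (h19 : ∀ (F : T4Family) (θ : Stage13HParams F N) (hP : θ.Provisos₁₃CoPH F N), Rg F θ → θ.Admissible F N →
      B16.EndStatementBPrinted (datumOfRecord₁₃CoPH F N θ hP).C → DagBinding.EndpointExistence (datumOfRecord₁₃CoPH F N θ hP).C.toB12 →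
        ForSmallCouplings (datumOfRecord₁₃CoPH F N θ hP) fun g₀ => ∀ os : List (ULoop F),
          (RatesHolderAt (datumOfRecord₁₃CoPH F N θ hP) (rateCarriersOfRecord₁₃CoPH 𝔯 F θ hP g₀ os (ksel F θ hP g₀ os)) β ∧
              ReadOutAt (datumOfRecord₁₃CoPH F N θ hP) (rateCarriersOfRecord₁₃CoPH 𝔯 F θ hP g₀ os (ksel F θ hP g₀ os)).u3 ∧
              (0 ≤ (rateCarriersOfRecord₁₃CoPH 𝔯 F θ hP g₀ os (ksel F θ hP g₀ os)).u3.ρ ∧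
                (rateCarriersOfRecord₁₃CoPH 𝔯 F θ hP g₀ os (ksel F θ hP g₀ os)).u3.ρ < 1)) →
            letI : DecidableEq (Σ K, SiteSeqKey F (K₀ + K)) := Classical.decEq _
            ∃ δ : ℕ → ℝ, NE7.Core 1 (F.side ^ 4) (classSet₁₃ θ K₀ g₀) (badClass₁₃ θ K₀ g₀ (jc F θ hP g₀ os))
              (fun K t x => weightA₁₃ θ hP K₀ g₀ os K t x - (sh F θ hP g₀ os).1 K t x)
              (fun K t x => weightB₁₃ θ hP K₀ g₀ os K t x - (sh F θ hP g₀ os).2 K t x) δ ∧ Summable δ) :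
    Spine (N := N) fun F D w => Node00.IsRecordOfRecord₁₃CCoPHOn F N Rg D w := by
  obtain ⟨hS, hW⟩ := windowedRowsOfRecord₁₃_guarded_of_kingMechanism ℓ s ρd q p₁ p₂ uA vA CA uB vB CB κK θK VK sA sC sB cA cC cB Rg hs hks hρ0 hρtri hd hV hA hB hu hCA hvA hCB hvB hdu hdC hdv hdom
  exact spine_rec13CCoPHOn_of_v5pins_fsc_at_crOfRecord₁₃VAt_cut_of_finiteVolumeLetters K₀ jc sh β 𝔯 ksel ℓ s r ℓ₃ B Rg hpin1 hpin2 hpinL hpin h16 hs hκ hcr hρ hr hinc hS h9 hW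
    hsel hζm h20 h21 h19

/-! ## §2 ON THE LIVE-SELECTOR LINE of a regime `G` (`Rg := G ∧ LiveSel` spelled `N`-generically; `hsel := hRg.2`) -/

section Live

variable (G : (F : T4Family) → Stage13HParams F N → Prop)

/-- ★★★ **§1 ON THE LIVE LINE OF A REGIME `G`**: at `N = 2`, `G :=` the item's guard, `K₀ = 0` the displayed binders ARE v5's stub-1 content AT ITS FOUR PINS (rows discharged; `h16` + `hr hinc h9`
+ KING's MECHANISM ROWS for the N18 ∕ (D4) rows + letter rows + the FSC `h19` face remain) and v5's stub-2 content AT THE SPINE PIN (keyed N20 ∕ N21 witnesses; N27x a theorem), composed to B5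
on the live line — the leaf `…SepCoPHAllPinsOfRecordVKingMechanism` gives THE ITEM.  Every row a HYPOTHESIS or a decided MODEL; King's rows NOT PRINTED for d = 4. [bookkeeping] -/
theorem spine_rec13CCoPHOn_live_of_v5pins_fsc_at_crOfRecord₁₃VAt_cut_of_kingMechanism
    (hpin1 : Ne1PinnedOfRecord 𝔯)
    (hpin2 : ∃ (b aS : ℝ) (ν μ α β' : Fin 4) (c35 p : ℝ), 0 < b ∧ 0 < aS ∧
      ∀ (F : T4Family) (θ : Stage13HParams F N) (hP : θ.Provisos₁₃CoPH F N) (g₀ : ℕ → ℝ) (os : List (ULoop F)) (k : ℕ),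
        (𝔯.lit F θ hP g₀ os).ne2 k = haveI := neZero_blockFactor F; fullGSizedObjects 3 F.hL b aS ν μ α β' c35 p)
    (hpinL : N16PinnedLoose 𝔯 ℓ₃ B)
    (hpin : ∀ (F : T4Family) (θ : Stage13HParams F N) (hP : θ.Provisos₁₃CoPH F N) (g₀ : ℕ → ℝ) (os : List (ULoop F)),
      (𝔯.lit F θ hP g₀ os).u3 = objectsOfRecord₁₃ F N θ.toStage13Params (ℓ F θ))
    (h16 : ∀ (F : T4Family), (∃ θ : Stage13HParams F N, θ.Provisos₁₃CoPH F N ∧ (G F θ ∧ θ.ppSel = ppSelLiveOfRecord F N θ.ν θ.τ9 (EOfRecord₁₃ F N θ.toStage13Params) (wOfRecord₉ F N θ.toStage9Params)) ∧ θ.Admissible F N) →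
      N16HolderAt (ne3OfRecord₁₁ F { ne3ConstLayerOfRecord₁₁ F N (ℓ₃ F) with
        dom := {V | V ∈ ne3DomOfRecord₁₁ F N 0 0 ∧ V ∈ sfClass 4 F.L (ne3NperOfRecord₁₁ F 0 0) ((ℓ₃ F).ε / B F) 0} }) β)
    (hs : ∀ (F : T4Family) (θ : Stage13HParams F N), θ.Provisos₁₃CoPH F N → (G F θ ∧ θ.ppSel = ppSelLiveOfRecord F N θ.ν θ.τ9 (EOfRecord₁₃ F N θ.toStage13Params) (wOfRecord₉ F N θ.toStage9Params)) → θ.Admissible F N → (ℓ F θ).Signs)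
    (hκ : ∀ (F : T4Family) (θ : Stage13HParams F N), θ.Provisos₁₃CoPH F N → (G F θ ∧ θ.ppSel = ppSelLiveOfRecord F N θ.ν θ.τ9 (EOfRecord₁₃ F N θ.toStage13Params) (wOfRecord₉ F N θ.toStage9Params)) → θ.Admissible F N → 0 < (ℓ F θ).κ)
    (hcr : ∀ (F : T4Family) (θ : Stage13HParams F N), θ.Provisos₁₃CoPH F N → (G F θ ∧ θ.ppSel = ppSelLiveOfRecord F N θ.ν θ.τ9 (EOfRecord₁₃ F N θ.toStage13Params) (wOfRecord₉ F N θ.toStage9Params)) → θ.Admissible F N →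
      betaPrime510 4 1 (ℓ F θ).κ ≤ (ℓ F θ).cr)
    (hρ : ∀ (F : T4Family) (θ : Stage13HParams F N), θ.Provisos₁₃CoPH F N → (G F θ ∧ θ.ppSel = ppSelLiveOfRecord F N θ.ν θ.τ9 (EOfRecord₁₃ F N θ.toStage13Params) (wOfRecord₉ F N θ.toStage9Params)) → θ.Admissible F N →
      0 ≤ (ℓ F θ).ρ ∧ (ℓ F θ).ρ < 1)
    (hr : ∀ (F : T4Family) (θ : Stage13HParams F N), θ.Provisos₁₃CoPH F N → (G F θ ∧ θ.ppSel = ppSelLiveOfRecord F N θ.ν θ.τ9 (EOfRecord₁₃ F N θ.toStage13Params) (wOfRecord₉ F N θ.toStage9Params)) → θ.Admissible F N → r F θ < 1)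
    (hinc : ∀ (F : T4Family) (θ : Stage13HParams F N), θ.Provisos₁₃CoPH F N → (G F θ ∧ θ.ppSel = ppSelLiveOfRecord F N θ.ν θ.τ9 (EOfRecord₁₃ F N θ.toStage13Params) (wOfRecord₉ F N θ.toStage9Params)) → θ.Admissible F N →
      GeometricIncrementsOfRecord₁₃ F N θ.toStage13Params (r F θ))
    (h9 : ∀ (F : T4Family) (θ : Stage13HParams F N), θ.Provisos₁₃CoPH F N → (G F θ ∧ θ.ppSel = ppSelLiveOfRecord F N θ.ν θ.τ9 (EOfRecord₁₃ F N θ.toStage13Params) (wOfRecord₉ F N θ.toStage9Params)) → θ.Admissible F N →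
      WindowedNE9OfRecord₁₃ F N θ.toStage13Params (ℓ F θ).κ (ℓ F θ).moduli)
    (hks : ∀ (F : T4Family) (θ : Stage13HParams F N), θ.Provisos₁₃CoPH F N → (G F θ ∧ θ.ppSel = ppSelLiveOfRecord F N θ.ν θ.τ9 (EOfRecord₁₃ F N θ.toStage13Params) (wOfRecord₉ F N θ.toStage9Params)) → θ.Admissible F N →
      0 ≤ κK F θ ∧ 0 ≤ θK F θ ∧ 0 ≤ sA F θ ∧ 0 ≤ sC F θ ∧ 0 ≤ sB F θ ∧ 0 ≤ cA F θ ∧ 0 ≤ cC F θ ∧ 0 ≤ cB F θ)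
    (hρ0 : ∀ (F : T4Family) (θ : Stage13HParams F N) (K k : ℕ) (t t' : PK F θ K k), 0 ≤ ρd F θ K k t t')
    (hρtri : ∀ (F : T4Family) (θ : Stage13HParams F N) (K k : ℕ) (t t' t'' : PK F θ K k), ρd F θ K k t t'' ≤ ρd F θ K k t t' + ρd F θ K k t' t'')
    (hd : ∀ (F : T4Family) (θ : Stage13HParams F N) (K k : ℕ) (μ ν : Fin 4) (x : Fin 4 → ℤ), l1 x ≤ ρd F θ K k (p₁ F θ K k μ ν x) (p₂ F θ K k μ ν x))
    (hV : ∀ (F : T4Family) (θ : Stage13HParams F N), θ.Provisos₁₃CoPH F N → (G F θ ∧ θ.ppSel = ppSelLiveOfRecord F N θ.ν θ.τ9 (EOfRecord₁₃ F N θ.toStage13Params) (wOfRecord₉ F N θ.toStage9Params)) → θ.Admissible F N →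
      ∀ (K k : ℕ) (t : PK F θ K k), ∑ i, Real.exp (-(κK F θ / 2 * ρd F θ K k t (q F θ K k i))) ≤ VK F θ)
    (hA : ∀ (F : T4Family) (θ : Stage13HParams F N), θ.Provisos₁₃CoPH F N → (G F θ ∧ θ.ppSel = ppSelLiveOfRecord F N θ.ν θ.τ9 (EOfRecord₁₃ F N θ.toStage13Params) (wOfRecord₉ F N θ.toStage9Params)) → θ.Admissible F N →
      (letI := θ.instVβ₁; letI := θ.instVβ₂; letI := θ.instιβ
      ∀ (k : ℕ) (v : Fin (k + 1) → ℝ), v ∈ Box θ.γ k → ∀ (μ ν : Fin 4) (x : Fin 4 → ℤ), ∀ᶠ K in atTop,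
        polWindow F K (k + 1) (mergedTermFamilyMatT F N (TβOfRecord₁₃ F N) (chiβOfRecord₁₃ F N θ.toStage13Params) θ.εbg k v K) θ.ρ8 θ.bV μ ν x =
          uA F θ K k v μ ν x ⬝ᵥ (CA F θ K k v μ ν x *ᵥ vA F θ K k v μ ν x)))
    (hB : ∀ (F : T4Family) (θ : Stage13HParams F N), θ.Provisos₁₃CoPH F N → (G F θ ∧ θ.ppSel = ppSelLiveOfRecord F N θ.ν θ.τ9 (EOfRecord₁₃ F N θ.toStage13Params) (wOfRecord₉ F N θ.toStage9Params)) → θ.Admissible F N →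
      (letI := θ.instVβ₁; letI := θ.instVβ₂; letI := θ.instιβ
      ∀ (k : ℕ) (w : Fin (k + 2) → ℝ), w ∈ Box θ.γ (k + 1) → ∀ (μ ν : Fin 4) (x : Fin 4 → ℤ), ∀ᶠ K in atTop,
        polWindow F (K + s F θ) (k + 1 + 1) (mergedTermFamilyMatT F N (TβOfRecord₁₃ F N) (chiβOfRecord₁₃ F N θ.toStage13Params) θ.εbg (k + 1) w (K + s F θ)) θ.ρ8 θ.bV μ ν x =
          uB F θ K k w μ ν x ⬝ᵥ (CB F θ K k w μ ν x *ᵥ vB F θ K k w μ ν x)))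
    (hu : ∀ (F : T4Family) (θ : Stage13HParams F N), θ.Provisos₁₃CoPH F N → (G F θ ∧ θ.ppSel = ppSelLiveOfRecord F N θ.ν θ.τ9 (EOfRecord₁₃ F N θ.toStage13Params) (wOfRecord₉ F N θ.toStage9Params)) → θ.Admissible F N →
      ∀ (K k : ℕ) (v : Fin (k + 1) → ℝ) (μ ν : Fin 4) (x : Fin 4 → ℤ) (i : βK F θ K k),
        |uA F θ K k v μ ν x i| ≤ sA F θ * Real.exp (-(κK F θ * ρd F θ K k (p₁ F θ K k μ ν x) (q F θ K k i))))
    (hCA : ∀ (F : T4Family) (θ : Stage13HParams F N), θ.Provisos₁₃CoPH F N → (G F θ ∧ θ.ppSel = ppSelLiveOfRecord F N θ.ν θ.τ9 (EOfRecord₁₃ F N θ.toStage13Params) (wOfRecord₉ F N θ.toStage9Params)) → θ.Admissible F N →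
      ∀ (K k : ℕ) (v : Fin (k + 1) → ℝ) (μ ν : Fin 4) (x : Fin 4 → ℤ) (i i' : βK F θ K k),
        |CA F θ K k v μ ν x i i'| ≤ sC F θ * Real.exp (-(κK F θ * ρd F θ K k (q F θ K k i) (q F θ K k i'))))
    (hvA : ∀ (F : T4Family) (θ : Stage13HParams F N), θ.Provisos₁₃CoPH F N → (G F θ ∧ θ.ppSel = ppSelLiveOfRecord F N θ.ν θ.τ9 (EOfRecord₁₃ F N θ.toStage13Params) (wOfRecord₉ F N θ.toStage9Params)) → θ.Admissible F N →
      ∀ (K k : ℕ) (v : Fin (k + 1) → ℝ) (μ ν : Fin 4) (x : Fin 4 → ℤ) (i' : βK F θ K k),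
        |vA F θ K k v μ ν x i'| ≤ sB F θ * Real.exp (-(κK F θ * ρd F θ K k (q F θ K k i') (p₂ F θ K k μ ν x))))
    (hCB : ∀ (F : T4Family) (θ : Stage13HParams F N), θ.Provisos₁₃CoPH F N → (G F θ ∧ θ.ppSel = ppSelLiveOfRecord F N θ.ν θ.τ9 (EOfRecord₁₃ F N θ.toStage13Params) (wOfRecord₉ F N θ.toStage9Params)) → θ.Admissible F N →
      ∀ (K k : ℕ) (w : Fin (k + 2) → ℝ) (μ ν : Fin 4) (x : Fin 4 → ℤ) (i i' : βK F θ K k),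
        |CB F θ K k w μ ν x i i'| ≤ sC F θ * Real.exp (-(κK F θ * ρd F θ K k (q F θ K k i) (q F θ K k i'))))
    (hvB : ∀ (F : T4Family) (θ : Stage13HParams F N), θ.Provisos₁₃CoPH F N → (G F θ ∧ θ.ppSel = ppSelLiveOfRecord F N θ.ν θ.τ9 (EOfRecord₁₃ F N θ.toStage13Params) (wOfRecord₉ F N θ.toStage9Params)) → θ.Admissible F N →
      ∀ (K k : ℕ) (w : Fin (k + 2) → ℝ) (μ ν : Fin 4) (x : Fin 4 → ℤ) (i' : βK F θ K k),
        |vB F θ K k w μ ν x i'| ≤ sB F θ * Real.exp (-(κK F θ * ρd F θ K k (q F θ K k i') (p₂ F θ K k μ ν x))))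
    (hdu : ∀ (F : T4Family) (θ : Stage13HParams F N), θ.Provisos₁₃CoPH F N → (G F θ ∧ θ.ppSel = ppSelLiveOfRecord F N θ.ν θ.τ9 (EOfRecord₁₃ F N θ.toStage13Params) (wOfRecord₉ F N θ.toStage9Params)) → θ.Admissible F N →
      ∀ (K k : ℕ) (w : Fin (k + 2) → ℝ) (μ ν : Fin 4) (x : Fin 4 → ℤ) (i : βK F θ K k),
        |uB F θ K k w μ ν x i - uA F θ K k (Fin.tail w) μ ν x i| ≤
          cA F θ * θK F θ ^ (k + 1) * Real.exp (-(κK F θ * ρd F θ K k (p₁ F θ K k μ ν x) (q F θ K k i))))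
    (hdC : ∀ (F : T4Family) (θ : Stage13HParams F N), θ.Provisos₁₃CoPH F N → (G F θ ∧ θ.ppSel = ppSelLiveOfRecord F N θ.ν θ.τ9 (EOfRecord₁₃ F N θ.toStage13Params) (wOfRecord₉ F N θ.toStage9Params)) → θ.Admissible F N →
      ∀ (K k : ℕ) (w : Fin (k + 2) → ℝ) (μ ν : Fin 4) (x : Fin 4 → ℤ) (i i' : βK F θ K k),
        |CB F θ K k w μ ν x i i' - CA F θ K k (Fin.tail w) μ ν x i i'| ≤
          cC F θ * θK F θ ^ (k + 1) * Real.exp (-(κK F θ * ρd F θ K k (q F θ K k i) (q F θ K k i'))))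
    (hdv : ∀ (F : T4Family) (θ : Stage13HParams F N), θ.Provisos₁₃CoPH F N → (G F θ ∧ θ.ppSel = ppSelLiveOfRecord F N θ.ν θ.τ9 (EOfRecord₁₃ F N θ.toStage13Params) (wOfRecord₉ F N θ.toStage9Params)) → θ.Admissible F N →
      ∀ (K k : ℕ) (w : Fin (k + 2) → ℝ) (μ ν : Fin 4) (x : Fin 4 → ℤ) (i' : βK F θ K k),
        |vB F θ K k w μ ν x i' - vA F θ K k (Fin.tail w) μ ν x i'| ≤
          cB F θ * θK F θ ^ (k + 1) * Real.exp (-(κK F θ * ρd F θ K k (q F θ K k i') (p₂ F θ K k μ ν x))))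
    (hdom : ∀ (F : T4Family) (θ : Stage13HParams F N), θ.Provisos₁₃CoPH F N → (G F θ ∧ θ.ppSel = ppSelLiveOfRecord F N θ.ν θ.τ9 (EOfRecord₁₃ F N θ.toStage13Params) (wOfRecord₉ F N θ.toStage9Params)) → θ.Admissible F N →
      (ℓ F θ).κ ≤ κK F θ / 2 ∧ θK F θ ≤ (ℓ F θ).θ₅ ∧
        ((cA F θ * sC F θ * sB F θ + sA F θ * cC F θ * sB F θ + sA F θ * sC F θ * cB F θ) * VK F θ ^ 2) * θK F θ ≤ (ℓ F θ).C₅ * (ℓ F θ).θ₅)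
    (hζm : ∀ (F : T4Family) (θ : Stage13HParams F N), θ.Provisos₁₃CoPH F N → (G F θ ∧ θ.ppSel = ppSelLiveOfRecord F N θ.ν θ.τ9 (EOfRecord₁₃ F N θ.toStage13Params) (wOfRecord₉ F N θ.toStage9Params)) → θ.Admissible F N →
      ZetaMeasurable F N θ.ζ)
    (h20 : ∀ (F : T4Family) (θ : Stage13HParams F N) (hP : θ.Provisos₁₃CoPH F N), (G F θ ∧ θ.ppSel = ppSelLiveOfRecord F N θ.ν θ.τ9 (EOfRecord₁₃ F N θ.toStage13Params) (wOfRecord₉ F N θ.toStage9Params)) → θ.Admissible F N →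
      ∀ (g₀ : ℕ → ℝ) (os : List (ULoop F)),
        ∃ W : ℕ → ℝ, RelWeightBound 1 (classSet₁₃ θ K₀ g₀) (weightA₁₃ θ hP K₀ g₀ os) (weightB₁₃ θ hP K₀ g₀ os) (badClass₁₃ θ K₀ g₀ (jc F θ hP g₀ os)) W)
    (h21 : ∀ (F : T4Family) (θ : Stage13HParams F N) (hP : θ.Provisos₁₃CoPH F N), (G F θ ∧ θ.ppSel = ppSelLiveOfRecord F N θ.ν θ.τ9 (EOfRecord₁₃ F N θ.toStage13Params) (wOfRecord₉ F N θ.toStage9Params)) → θ.Admissible F N →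
      ∀ (g₀ : ℕ → ℝ) (os : List (ULoop F)),
        ∃ Wsh : ℕ → ℝ, ShellWeightBound 1 (classSet₁₃ θ K₀ g₀) (weightA₁₃ θ hP K₀ g₀ os) (weightB₁₃ θ hP K₀ g₀ os) (sh F θ hP g₀ os).1 (sh F θ hP g₀ os).2 Wsh)
    (h19 : ∀ (F : T4Family) (θ : Stage13HParams F N) (hP : θ.Provisos₁₃CoPH F N), (G F θ ∧ θ.ppSel = ppSelLiveOfRecord F N θ.ν θ.τ9 (EOfRecord₁₃ F N θ.toStage13Params) (wOfRecord₉ F N θ.toStage9Params)) → θ.Admissible F N →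
      B16.EndStatementBPrinted (datumOfRecord₁₃CoPH F N θ hP).C → DagBinding.EndpointExistence (datumOfRecord₁₃CoPH F N θ hP).C.toB12 →
        ForSmallCouplings (datumOfRecord₁₃CoPH F N θ hP) fun g₀ => ∀ os : List (ULoop F),
          (RatesHolderAt (datumOfRecord₁₃CoPH F N θ hP) (rateCarriersOfRecord₁₃CoPH 𝔯 F θ hP g₀ os (ksel F θ hP g₀ os)) β ∧
              ReadOutAt (datumOfRecord₁₃CoPH F N θ hP) (rateCarriersOfRecord₁₃CoPH 𝔯 F θ hP g₀ os (ksel F θ hP g₀ os)).u3 ∧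
              (0 ≤ (rateCarriersOfRecord₁₃CoPH 𝔯 F θ hP g₀ os (ksel F θ hP g₀ os)).u3.ρ ∧
                (rateCarriersOfRecord₁₃CoPH 𝔯 F θ hP g₀ os (ksel F θ hP g₀ os)).u3.ρ < 1)) →
            letI : DecidableEq (Σ K, SiteSeqKey F (K₀ + K)) := Classical.decEq _
            ∃ δ : ℕ → ℝ, NE7.Core 1 (F.side ^ 4) (classSet₁₃ θ K₀ g₀) (badClass₁₃ θ K₀ g₀ (jc F θ hP g₀ os))
              (fun K t x => weightA₁₃ θ hP K₀ g₀ os K t x - (sh F θ hP g₀ os).1 K t x)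
              (fun K t x => weightB₁₃ θ hP K₀ g₀ os K t x - (sh F θ hP g₀ os).2 K t x) δ ∧ Summable δ) :
    Spine (N := N) fun F D w => Node00.IsRecordOfRecord₁₃CCoPHOn F N
      (fun F θ => G F θ ∧ θ.ppSel = ppSelLiveOfRecord F N θ.ν θ.τ9 (EOfRecord₁₃ F N θ.toStage13Params) (wOfRecord₉ F N θ.toStage9Params)) D w :=
  spine_rec13CCoPHOn_of_v5pins_fsc_at_crOfRecord₁₃VAt_cut_of_kingMechanism K₀ jc sh β 𝔯 ksel ℓ s r ℓ₃ B ρd q p₁ p₂ uA vA CA uB vB CB κK θK VK sA sC sB cA cC cB _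
    hpin1 hpin2 hpinL hpin h16 hs hκ hcr hρ hr hinc h9 hks hρ0 hρtri hd hV hA hB hu hCA hvA hCB hvB hdu hdC hdv hdom
    (fun _ _ _ hRg _ => ⟨_, hRg.2⟩) hζm h20 h21 h19

end Live

end Summit.QuantumFields.YangMills.Theorems.BalabanUVNodesN27SpineRecord
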